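import Summits.KontsevichZagierPeriods.KontsevichZagierPeriods.Theorems.TerasomaMultiplicationCompleteModGammaSectorElliottToCusp

/-!
# Cusp transport, scaled product form
# (`CompleteModGammaSector`, stmt-KontsevichZagierPeriods-14233, line `cusp-transport-to-the-beta-world`)

The product-form corollary of `CompleteModGammaSectorCuspLine.elliottToCusp_smul`: with
`k(t;z) = t^{−a}(1−t)^{c+a−2}(1−zt)^{−a}`, the scaled Elliott–Legendre representation written as
`[(0,1)², α·(k(t;z₁)k(u;1−z₁)·(1 − z₁t − (1−z₁)u))]` is KZ-equivalent to the flat scaled cusp cube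
`[(0,1)², α·t^{−a}(1−t)^{c+a−2}u^{−a}(1−u)^{c−1}]`, for rational `0 < a < 1`, `1 − a < c`, a real
algebraic modulus `z₁ ∈ (0,1)` and a real algebraic constant `α`. The Legendre-sector assembly
consumes it at `a = ½`, `c = 1`, `α = ¼`.

The proof is pure pointwise algebra on the open square: `e(t;z) = k(t;z)(1 − zt)` via
`Real.rpow_add_one` (for `x ∈ (0,1)²`, `1 − z₁x₀ > 0` and `1 − (1−z₁)x₁ > 0`).

References: M. Kontsevich, D. Zagier, *Periods* (2001), §1.2.
-/

noncomputable section

-- `Summit.KontsevichZagierPeriods.KontsevichZagierPeriods.…` is the tree's mandated layout (single-conjunct summit).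
set_option linter.dupNamespace false

namespace Summit.KontsevichZagierPeriods.KontsevichZagierPeriods.CompleteModGammaSectorCuspLine

open MeasureTheory Set
open Literature.NumberTheory.Transcendental
open Literature.NumberTheory.Transcendental.KZ

/-- **Cusp transport, scaled product form** (`elliottToCusp_smul` with the Elliott–Legendre
integrand in product form `α·(k(t;z₁)k(u;1−z₁)·(1 − z₁t − (1−z₁)u))`,
`k(t;z) = t^{−a}(1−t)^{c+a−2}(1−zt)^{−a}`, and the cusp cube written flat
`α·t^{−a}(1−t)^{c+a−2}u^{−a}(1−u)^{c−1}`): for rational `0 < a < 1`, `1 − a < c`, a real algebraic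
modulus `z₁ ∈ (0,1)` and a real algebraic constant `α`, the two representations on `(0,1)²` are
KZ-equivalent — derived from `elliottToCusp_smul` by the pointwise identity `e(t;z) = k(t;z)(1 − zt)`.
[cite: KontsevichZagier2001, §1.2] -/
theorem elliottToCusp_smul_prod : ∀ (a c : ℚ) (z₁ α : ℝ), 0 < a → a < 1 → 1 - a < c → 0 < z₁ → z₁ < 1 → IsAlgebraic ℚ z₁ → IsAlgebraic ℚ α → ∀ (r ρ : IntegralRep 2), r.domain = {x | ∀ i, x i ∈ Set.Ioo (0:ℝ) 1} → Set.EqOn r.integrand (fun x : Fin 2 → ℝ => α * (((x 0 ^ (-(a : ℝ)) * (1 - x 0) ^ ((c : ℝ) + (a : ℝ) - 2) * (1 - z₁ * x 0) ^ (-(a : ℝ)) * x 1 ^ (-(a : ℝ)) * (1 - x 1) ^ ((c : ℝ) + (a : ℝ) - 2) * (1 - (1 - z₁) * x 1) ^ (-(a : ℝ))) * (1 - z₁ * x 0 - (1 - z₁) * x 1)))) r.domain → ρ.domain = {x | ∀ i, x i ∈ Set.Ioo (0:ℝ) 1} → Set.EqOn ρ.integrand (fun x : Fin 2 → ℝ =>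 α * ((x 0) ^ (-(a : ℝ)) * (1 - x 0) ^ ((c : ℝ) + (a : ℝ) - 2) * (x 1) ^ (-(a : ℝ)) * (1 - x 1) ^ ((c : ℝ) - 1))) ρ.domain → Equivalent r ρ := by
  intro a c z₁ α ha0 ha1 hac hz0 hz1 hzalg hα r ρ hrd hri hρd hρi
  refine elliottToCusp_smul a c z₁ α ha0 ha1 hac hz0 hz1 hzalg hα r ρ hrd (fun x hx => ?_) hρd
    (fun x hx => ?_)
  · rw [hri hx]
    rw [hrd] at hx
    have hx0 := hx 0
    have hx1 := hx 1
    have h1t : 0 < 1 - z₁ * x 0 := by nlinarith [hx0.1, hx0.2]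
    have h1u : 0 < 1 - (1 - z₁) * x 1 := by nlinarith [hx1.1, hx1.2]
    have e1 : (1 - z₁ * x 0) ^ (1 - (a : ℝ)) = (1 - z₁ * x 0) ^ (-(a : ℝ)) * (1 - z₁ * x 0) := by
      rw [← Real.rpow_add_one h1t.ne']
      congr 1
      ring
    have e2 : (1 - (1 - z₁) * x 1) ^ (1 - (a : ℝ)) =
        (1 - (1 - z₁) * x 1) ^ (-(a : ℝ)) * (1 - (1 - z₁) * x 1) := by
      rw [← Real.rpow_add_one h1u.ne']
      congr 1
      ring
    simp only [e1, e2]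
    ring
  · rw [hρi hx]
    beta_reduce
    ring

end Summit.KontsevichZagierPeriods.KontsevichZagierPeriods.CompleteModGammaSectorCuspLine
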